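import Summits.ValiantsHypothesis.ValiantsHypothesis.Theorems.LacunarySymmetroidMatrixDescartesDoorA26WallBubblingTwoSlopeSigned
import Summits.ValiantsHypothesis.ValiantsHypothesis.Theorems.LacunarySymmetroidMatrixDescartesDoorA26WallBubblingPrincipalMinors

/-!
# Wall bubbling for `DoorA26` — the signed two-slope law meets INERTIA: one-signed top classes of two principal 3-minors cannot have opposite signs

HONEST FRAMING.  Helper theorems for the line `Cruxes/DoorA26/Lines/wall_bubbling.lean` (crux stmt-ValiantsHypothesis-19979 `DoorA26`; OPEN, typed,
never asserted), W2 seat val-sym-door-p1 g16, on top of W2 #37 `…WallBubblingTwoSlopeSigned` and W1's PM3 row `…WallBubblingPrincipalMinors`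
(`principal_three_sign_persists`: along a sequence of realisable Grams two principal `3 × 3` minors are never eventually of opposite strict signs).
Def-free; nothing here bears on `DoorA26`, `MatrixDescartes` (stmt-ValiantsHypothesis-18050) or `VP ≠ VNP`; registers unchanged.

CONTENT.  §1 `eventually_pos_of_oneSigned_class`: the positive-conclusion twin of #37's `false_of_oneSigned_class` (no vanishing identity assumed;
conclusion: the finite sum is EVENTUALLY STRICTLY POSITIVE).  §2 `det_eventually_pos_of_topClass_oneSigned` / `_neg`: a minor whose two-slope top class
is one-signed has eventually that strict sign.  §3 `false_of_principal_three_topClasses_opposite`: for realisable `G^ν` (rank ≤ 3, inertia of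
`(Sym₂ℝ, det)`), two principal 3-minors with one-signed top classes of OPPOSITE signs are a contradiction — the signed PM3 row of the census (located, hub
re-run of record R2: with the 4×4 signed law it kills 41 046 of the 49 552 two-cluster profiles at generic support in both sign classes).

[folklore] limits and signs of finite sums; [this work] the wiring.
-/

-- `Summit.ValiantsHypothesis.ValiantsHypothesis.…` repeats a component by the D-0017 layout
-- (single-conjunct summit), which the `dupNamespace` linter flags; the name is mandated.
set_option linter.dupNamespace false

namespace Summit.ValiantsHypothesis.ValiantsHypothesis.Theorems.LacunarySymmetroidMatrixDescartes.WallBubbling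

open Finset Filter Topology
open scoped BigOperators

/-! ## §1 A one-signed dominant class makes the sum eventually positive -/

/-- **One-signed dominant class ⇒ eventually positive sum.**  As in `false_of_oneSigned_class` but without the vanishing identity: the finite sum
`Σ_i X^ν_i` is eventually strictly positive. [folklore] -/
theorem eventually_pos_of_oneSigned_class {ι : Type*} [Fintype ι] [DecidableEq ι] (X E : ℕ → ι → ℝ) (c : ι → ℝ) (T : Finset ι)
    (j : ι) (hj : j ∈ T)
    (hX : ∀ i, Tendsto (fun ν => X ν i * Real.exp (E ν i)) atTop (𝓝 (c i)))
    (hpos : ∀ i ∈ T, 0 < c i)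
    (hgap : ∀ i, i ∉ T → ∀ j ∈ T, Tendsto (fun ν => E ν i - E ν j) atTop atTop) :
    ∀ᶠ ν in atTop, 0 < ∑ i, X ν i := by
  classical
  set Y : ℕ → ι → ℝ := fun ν i => X ν i * Real.exp (E ν j) with hY
  have hin : ∀ i ∈ T, ∀ᶠ ν in atTop, 0 ≤ Y ν i := by
    intro i hi
    have h := (hX i).eventually (lt_mem_nhds (hpos i hi))
    refine h.mono fun ν hν => ?_
    have : Y ν i = (X ν i * Real.exp (E ν i)) * Real.exp (E ν j - E ν i) := by
      rw [hY]; simp only; rw [mul_assoc, ← Real.exp_add]; congr 1; ring_nf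
    rw [this]
    exact mul_nonneg hν.le (Real.exp_pos _).le
  have hjj : ∀ᶠ ν in atTop, c j / 2 < Y ν j := by
    have h := (hX j).eventually (lt_mem_nhds (show c j / 2 < c j by linarith [hpos j hj]))
    exact h.mono fun ν hν => by rw [hY]; exact hν
  have hout : ∀ i, i ∉ T → Tendsto (fun ν => Y ν i) atTop (𝓝 0) := by
    intro i hi
    have hfac : ∀ ν, Y ν i = (X ν i * Real.exp (E ν i)) * Real.exp (-(E ν i - E ν j)) := by
      intro ν; rw [hY]; simp only; rw [mul_assoc, ← Real.exp_add]; congr 1; ring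
    simp_rw [hfac]
    have hexp : Tendsto (fun ν => Real.exp (-(E ν i - E ν j))) atTop (𝓝 0) :=
      Real.tendsto_exp_atBot.comp (tendsto_neg_atTop_atBot.comp (hgap i hi j hj))
    simpa using (hX i).mul hexp
  have hout_sum : Tendsto (fun ν => ∑ i ∈ Tᶜ, Y ν i) atTop (𝓝 0) := by
    have := tendsto_finsetSum (Tᶜ) fun i (hi : i ∈ Tᶜ) => hout i (Finset.mem_compl.mp hi)
    simpa using this
  have hout_ev : ∀ᶠ ν in atTop, -(c j / 2) < ∑ i ∈ Tᶜ, Y ν i :=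
    hout_sum.eventually (lt_mem_nhds (by linarith [hpos j hj]))
  have hin_ev : ∀ᶠ ν in atTop, ∀ i ∈ T, 0 ≤ Y ν i := (Finset.eventually_all T).mpr hin
  filter_upwards [hin_ev, hjj, hout_ev] with ν hν1 hν2 hν3
  have hsplit : ∑ i, Y ν i = ∑ i ∈ T, Y ν i + ∑ i ∈ Tᶜ, Y ν i :=
    (Finset.sum_add_sum_compl T (Y ν)).symm
  have hT : Y ν j ≤ ∑ i ∈ T, Y ν i := Finset.single_le_sum (fun i hi => hν1 i hi) hj
  have hYpos : 0 < ∑ i, Y ν i := by linarith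
  have hYeq : ∑ i, Y ν i = (∑ i, X ν i) * Real.exp (E ν j) := by
    rw [hY]; simp only; rw [Finset.sum_mul]
  rw [hYeq] at hYpos
  exact (mul_pos_iff_of_pos_right (Real.exp_pos _)).mp hYpos

/-! ## §2 Eventual sign of a minor with a one-signed top class -/

/-- **Minor with one-signed POSITIVE top class is eventually positive.**  Entries with (possibly moving) two-slope asymptotics
`G_pq/(R_p C_q)·e^{Δ^ν a^ν_pq} → γ_pq` (`R, C > 0`); a non-empty class `T` of permutations with strictly positive signed `γ`-monomials dominating all the
others after the rate.  Then `det (G^ν)_{r,c} > 0` eventually. [this work] -/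
theorem det_eventually_pos_of_topClass_oneSigned {n k : ℕ} (G : ℕ → Matrix (Fin n) (Fin n) ℝ) (r c : Fin k → Fin n)
    (γ : Fin n → Fin n → ℝ) (a : ℕ → Fin n → Fin n → ℝ) (R C : ℕ → Fin n → ℝ) (hR : ∀ ν p, 0 < R ν p) (hC : ∀ ν q, 0 < C ν q)
    (Δ : ℕ → ℝ)
    (hG : ∀ p q, Tendsto (fun ν => G ν p q / (R ν p * C ν q) * Real.exp (Δ ν * a ν p q)) atTop (𝓝 (γ p q)))
    (T : Finset (Equiv.Perm (Fin k))) (σ₀ : Equiv.Perm (Fin k)) (hσ₀ : σ₀ ∈ T)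
    (hpos : ∀ σ ∈ T, 0 < ((Equiv.Perm.sign σ : ℤ) : ℝ) * ∏ i, γ (r (σ i)) (c i))
    (hgap : ∀ σ, σ ∉ T → ∀ τ ∈ T,
      Tendsto (fun ν => Δ ν * (∑ i, a ν (r (σ i)) (c i)) - Δ ν * (∑ i, a ν (r (τ i)) (c i))) atTop atTop) :
    ∀ᶠ ν in atTop, 0 < ((G ν).submatrix r c).det := by
  classical
  have hN : ∀ ν, 0 < (∏ i, R ν (r i)) * ∏ i, C ν (c i) := fun ν =>
    mul_pos (Finset.prod_pos fun i _ => hR ν _) (Finset.prod_pos fun i _ => hC ν _)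
  have h := eventually_pos_of_oneSigned_class
    (fun ν σ => ((Equiv.Perm.sign σ : ℤ) : ℝ) * (∏ i, G ν (r (σ i)) (c i)) / ((∏ i, R ν (r i)) * ∏ i, C ν (c i)))
    (fun ν σ => Δ ν * ∑ i, a ν (r (σ i)) (c i))
    (fun σ => ((Equiv.Perm.sign σ : ℤ) : ℝ) * ∏ i, γ (r (σ i)) (c i)) T σ₀ hσ₀
    (fun σ => minor_term_tendsto G r c γ a R C Δ hG σ) hpos hgap
  refine h.mono fun ν hν => ?_
  have hdet : ((G ν).submatrix r c).det
      = (∑ σ : Equiv.Perm (Fin k), ((Equiv.Perm.sign σ : ℤ) : ℝ) * (∏ i, G ν (r (σ i)) (c i))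
          / ((∏ i, R ν (r i)) * ∏ i, C ν (c i))) * ((∏ i, R ν (r i)) * ∏ i, C ν (c i)) := by
    rw [Matrix.det_apply']
    simp only [Matrix.submatrix_apply]
    rw [Finset.sum_mul]
    refine Finset.sum_congr rfl fun σ _ => ?_
    rw [div_mul_cancel₀ _ (hN ν).ne']
  rw [hdet]
  exact mul_pos hν (hN ν)

/-- **Minor with one-signed NEGATIVE top class is eventually negative.** [this work] -/
theorem det_eventually_neg_of_topClass_oneSigned {n k : ℕ} (G : ℕ → Matrix (Fin n) (Fin n) ℝ) (r c : Fin k → Fin n)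
    (γ : Fin n → Fin n → ℝ) (a : ℕ → Fin n → Fin n → ℝ) (R C : ℕ → Fin n → ℝ) (hR : ∀ ν p, 0 < R ν p) (hC : ∀ ν q, 0 < C ν q)
    (Δ : ℕ → ℝ)
    (hG : ∀ p q, Tendsto (fun ν => G ν p q / (R ν p * C ν q) * Real.exp (Δ ν * a ν p q)) atTop (𝓝 (γ p q)))
    (T : Finset (Equiv.Perm (Fin k))) (σ₀ : Equiv.Perm (Fin k)) (hσ₀ : σ₀ ∈ T)
    (hneg : ∀ σ ∈ T, ((Equiv.Perm.sign σ : ℤ) : ℝ) * ∏ i, γ (r (σ i)) (c i) < 0)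
    (hgap : ∀ σ, σ ∉ T → ∀ τ ∈ T,
      Tendsto (fun ν => Δ ν * (∑ i, a ν (r (σ i)) (c i)) - Δ ν * (∑ i, a ν (r (τ i)) (c i))) atTop atTop) :
    ∀ᶠ ν in atTop, ((G ν).submatrix r c).det < 0 := by
  classical
  -- apply the positive version to `−G` (all entry limits negate; `k`-fold products pick up the same factor on T? — no: use the class sum directly)
  have hN : ∀ ν, 0 < (∏ i, R ν (r i)) * ∏ i, C ν (c i) := fun ν =>
    mul_pos (Finset.prod_pos fun i _ => hR ν _) (Finset.prod_pos fun i _ => hC ν _)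
  have h := eventually_pos_of_oneSigned_class
    (fun ν σ => -(((Equiv.Perm.sign σ : ℤ) : ℝ) * (∏ i, G ν (r (σ i)) (c i)) / ((∏ i, R ν (r i)) * ∏ i, C ν (c i))))
    (fun ν σ => Δ ν * ∑ i, a ν (r (σ i)) (c i))
    (fun σ => -(((Equiv.Perm.sign σ : ℤ) : ℝ) * ∏ i, γ (r (σ i)) (c i))) T σ₀ hσ₀
    (fun σ => by
      have := (minor_term_tendsto G r c γ a R C Δ hG σ).neg
      refine this.congr' (Eventually.of_forall fun ν => ?_)
      simp only [neg_mul])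
    (fun σ hσ => neg_pos.mpr (hneg σ hσ)) hgap
  refine h.mono fun ν hν => ?_
  have hdet : ((G ν).submatrix r c).det
      = (∑ σ : Equiv.Perm (Fin k), ((Equiv.Perm.sign σ : ℤ) : ℝ) * (∏ i, G ν (r (σ i)) (c i))
          / ((∏ i, R ν (r i)) * ∏ i, C ν (c i))) * ((∏ i, R ν (r i)) * ∏ i, C ν (c i)) := by
    rw [Matrix.det_apply']
    simp only [Matrix.submatrix_apply]
    rw [Finset.sum_mul]
    refine Finset.sum_congr rfl fun σ _ => ?_
    rw [div_mul_cancel₀ _ (hN ν).ne']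
  rw [Finset.sum_neg_distrib] at hν
  rw [hdet]
  exact mul_neg_of_neg_of_pos (neg_pos.mp hν) (hN ν)

/-! ## §3 The signed PM3 row: two principal 3-minors with one-signed top classes of opposite signs -/

/-- **SIGNED PM3 KILL.**  Realisable Grams `G^ν` (W-line `Bubbling.Realisable`: polar Grams of symmetric `2 × 2` letters up to a global sign — inertia of
`(Sym₂ℝ, det)`), two-slope entry asymptotics, and two principal triples `S, S′` whose two-slope top classes are one-signed of OPPOSITE signs (positive on
`S`, negative on `S′`).  Contradiction: the minors are eventually `> 0` resp. `< 0`, against `principal_three_sign_persists` (W1 `…PrincipalMinors`).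
[this work] -/
theorem false_of_principal_three_topClasses_opposite (G : ℕ → Matrix (Fin 6) (Fin 6) ℝ) (hreal : ∀ ν, Bubbling.Realisable (G ν))
    (S S' : Fin 3 → Fin 6)
    (γ : Fin 6 → Fin 6 → ℝ) (a : ℕ → Fin 6 → Fin 6 → ℝ) (R C : ℕ → Fin 6 → ℝ) (hR : ∀ ν p, 0 < R ν p) (hC : ∀ ν q, 0 < C ν q)
    (Δ : ℕ → ℝ)
    (hG : ∀ p q, Tendsto (fun ν => G ν p q / (R ν p * C ν q) * Real.exp (Δ ν * a ν p q)) atTop (𝓝 (γ p q)))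
    (T : Finset (Equiv.Perm (Fin 3))) (σ₀ : Equiv.Perm (Fin 3)) (hσ₀ : σ₀ ∈ T)
    (hpos : ∀ σ ∈ T, 0 < ((Equiv.Perm.sign σ : ℤ) : ℝ) * ∏ i, γ (S (σ i)) (S i))
    (hgap : ∀ σ, σ ∉ T → ∀ τ ∈ T,
      Tendsto (fun ν => Δ ν * (∑ i, a ν (S (σ i)) (S i)) - Δ ν * (∑ i, a ν (S (τ i)) (S i))) atTop atTop)
    (T' : Finset (Equiv.Perm (Fin 3))) (σ₀' : Equiv.Perm (Fin 3)) (hσ₀' : σ₀' ∈ T')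
    (hneg : ∀ σ ∈ T', ((Equiv.Perm.sign σ : ℤ) : ℝ) * ∏ i, γ (S' (σ i)) (S' i) < 0)
    (hgap' : ∀ σ, σ ∉ T' → ∀ τ ∈ T',
      Tendsto (fun ν => Δ ν * (∑ i, a ν (S' (σ i)) (S' i)) - Δ ν * (∑ i, a ν (S' (τ i)) (S' i))) atTop atTop) : False :=
  principal_three_sign_persists G hreal S S'
    (det_eventually_pos_of_topClass_oneSigned G S S γ a R C hR hC Δ hG T σ₀ hσ₀ hpos hgap)
    (det_eventually_neg_of_topClass_oneSigned G S' S' γ a R C hR hC Δ hG T' σ₀' hσ₀' hneg hgap')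

end Summit.ValiantsHypothesis.ValiantsHypothesis.Theorems.LacunarySymmetroidMatrixDescartes.WallBubbling
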